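import Mathlib
import HarnessLib
import Literature.Combinatorics.Additive.StepBeyondKempermanSizeThree

/-!
# Grynkiewicz 2009, §6: the case `|A| = |(A + B)ᶜ| = 3` of Theorem 4.1 (type (VII))

[cite: Grynkiewicz2009, §6 (proof of Thm 4.1, p. 28)] [tag: critical-pair] [tag: inverse-theorem]

Topic `Literature/Combinatorics/Additive`.  Cell `mm-stpp` (D-0046), seat `mm-stpp-lit` (gen 23); the
port of D. J. Grynkiewicz, *A step beyond Kemperman's structure theorem*, Mathematika **55** (2009)
67–114 continued.  §6, CASE I, the paragraph after Claim 8 (print p. 28): «If `|A| = |\overline{A + B}| = 3`,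
then in view of Proposition 2.4 and the completed case `|A| = |B| = 3` (done in Claim 6), it follows that
the theorem holds with type (VII).  Therefore we can assume (in view of Claim 6) that at most one of
`|A|`, `|B|` and `|\overline{A + B}|` is equal to three.»

The printed sentence is unpacked as follows (everything below is in the print; only the routing is
made explicit).  By Proposition 2.4 (`isNonExtendible_pair_neg_compl`) the pair
`(X, Y) = (−A, \overline{A + B})` is non-extendible with `X + Y = B̄`, so `|X + Y| = |X| + |Y| = 6`,
`X + Y` is aperiodic (`B` is, `addStab_compl`) and `X`, `Y` are not quasi-periodic (Lemma 5.4,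
`not_isQuasiPeriodic_add_and_compl`).  The analysis of Claim 6 (`StepBeyondKempermanSizeThree.lean`),
recorded here in the sharper form `isAP_or_isTypeVI_of_card_eq_three` — for `|X| = |Y| = 3`,
`|X + Y| = 6`, `X`, `Y` not quasi-periodic: `X` is an arithmetic progression, or `Y` is, or `X` is a
translate of `Y` (type (VI)) —, then gives: (a) `−A`, hence `A`, a progression ⟹ (17) by Lemma 5.8
(the «else the proof is complete» of Claim 6); (b) `\overline{A + B}` a progression with difference `e`
⟹ by Lemma 5.8 for the pair `(\overline{A + B}, −A)` (`subsetDist_quasiProgression_compl_of_isAP`) the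
complement `B` of its sum is a quasi-progression with difference `e`, hence — `B` not being
quasi-periodic — a progression, and Lemma 5.8 for `(B, A)` gives (17); (c) `(X, Y)` of type (VI) ⟹
`(A, B)` is the dual of a type (VI) pair with respect to `G`, i.e. of type (VII), and the theorem holds
with quasi-period `G` (`isGrynkiewiczDecomp_top_of_bottom`).

MAIN RESULTS (0 definitions, 0 named facts; everything PROVED).
* `Grynkiewicz2009.isAP_or_isTypeVI_of_card_eq_three` — Claim 6's analysis as a trichotomy.
* `Grynkiewicz2009.isAP_of_isQuasiProgression_of_not_isQuasiPeriodic` — «since `B` is not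
  quasi-periodic, `d⊆(B, 𝒬𝒜𝒫_d) = 0` implies `B` is an arithmetic progression» (proof of Lemma 5.10).
* `Grynkiewicz2009.conclusion_of_card_eq_three_of_card_compl_eq_three` — **the case
  `|A| = |\overline{A + B}| = 3`** of Theorem 4.1 under the core-case standing assumptions:
  (17), or a decomposition with quasi-period `G` and `(A, B)` of type (VII).

## References
* D. J. Grynkiewicz, *A step beyond Kemperman's structure theorem*, Mathematika 55 (2009) 67–114,
  doi:10.1112/S0025579300000966, §6 (p. 28, after Claim 8), Prop 2.4, Lemma 5.4, Lemma 5.8, §6 Claim 6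
  [cite: Grynkiewicz2009, Thm 4.1 (proof, p. 28)] — held `paper:doi-10-1112-s0025579300000966`,
  p0028 read 2026-08-29.
-/

namespace Literature.Combinatorics.Additive

open Finset
open scoped Pointwise

universe u

variable {G : Type u} [AddCommGroup G] [DecidableEq G]

namespace Grynkiewicz2009

/-- `(g + A) + (g' + B) = (g + g') + (A + B)`. [cite: Grynkiewicz2009, §2] -/
private theorem vadd_add_vadd_eq₄ (A B : Finset G) (g g' : G) :
    (g +ᵥ A) + (g' +ᵥ B) = (g + g') +ᵥ (A + B) := by
  rw [vadd_add_assoc, add_comm A (g' +ᵥ B), vadd_add_assoc, vadd_vadd, add_comm B A]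

/-! ### Claim 6's analysis as a trichotomy -/

/-- Claim 6's analysis in normal position (`0, d ∈ A ∩ B`, `d ≠ 0`): for `|A| = |B| = 3` with
`|A + B| = |A| + |B|` and `A`, `B` not quasi-periodic, `A` is an arithmetic progression, or `B` is, or
`A = B`.  (The printed case analysis of Claim 6: `exists_common_difference`, `claim6_facts`,
`claim6_count`, `claim6_final`.) [cite: Grynkiewicz2009, §6 Claim 6 (pp. 26–27)] -/
theorem isAP_or_eq_of_card_eq_three₀ {A B : Finset G} {d : G} (hd : d ≠ 0)
    (h0A : (0 : G) ∈ A) (hdA : d ∈ A) (h0B : (0 : G) ∈ B) (hdB : d ∈ B)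
    (hA3 : #A = 3) (hB3 : #B = 3) (hAB : #(A + B) = #A + #B)
    (hAqp : ¬ IsQuasiPeriodic A) (hBqp : ¬ IsQuasiPeriodic B) :
    (∃ e, IsAP A e) ∨ (∃ e, IsAP B e) ∨ A = B := by
  classical
  by_cases hAP : ∃ e, IsAP A e
  · exact Or.inl hAP
  by_cases hBP : ∃ e, IsAP B e
  · exact Or.inr (Or.inl hBP)
  obtain ⟨a₁, ha₁0, ha₁d, hAeq⟩ := eq_triple_of_card_eq_three hA3 h0A hdA hd.symm
  obtain ⟨a₂, ha₂0, ha₂d, hBeq⟩ := eq_triple_of_card_eq_three hB3 h0B hdB hd.symm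
  have ha₁A : a₁ ∈ A := by rw [hAeq]; simp
  have ha₂B : a₂ ∈ B := by rw [hBeq]; simp
  by_cases h12 : a₁ = a₂
  · exact Or.inr (Or.inr (by rw [hAeq, hBeq, h12]))
  obtain ⟨h2d, h2a₁, ha₁2d, ha₁nd, h2a₁d⟩ := claim6_facts hA3 hAeq hd ha₁0 hAP hAqp
  obtain ⟨-, h2a₂, ha₂2d, ha₂nd, h2a₂d⟩ := claim6_facts hB3 hBeq hd ha₂0 hBP hBqp
  have hAB6 : #(A + B) = 6 := by rw [hAB, hA3, hB3]
  exfalso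
  rcases claim6_count h0A hdA ha₁A h0B hdB ha₂B hAB6 hd h2d ha₁0 ha₁d ha₂0 ha₂d h12 ha₁2d ha₁nd
    ha₂2d ha₂nd with hc | hc
  · subst hc
    exact claim6_final h0A hdA ha₁A h0B hdB ha₂B hAB6 hd h2d ha₁0 ha₁d ha₁2d ha₁nd ha₂nd h2a₁ h2a₁d
      (fun h => hBP ⟨-a₁, claim6_isAP_of_eq hB3 hBeq h⟩)
  · subst hc
    have hBA6 : #(B + A) = 6 := by rw [add_comm]; exact hAB6
    exact claim6_final h0B hdB ha₂B h0A hdA ha₁A hBA6 hd h2d ha₂0 ha₂d ha₂2d ha₂nd ha₁nd h2a₂ h2a₂d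
      (fun h => hAP ⟨-a₂, claim6_isAP_of_eq hA3 hAeq h⟩)

/-- **Claim 6's analysis as a trichotomy.**  For `|A| = |B| = 3` with `|A + B| = |A| + |B|` and `A`, `B`
not quasi-periodic: `A` is an arithmetic progression, or `B` is, or `(A, B)` is of type (VI) (`A` is a
translate of `B`).  (Common difference, translation to normal position, and
`isAP_or_eq_of_card_eq_three₀`.) [cite: Grynkiewicz2009, §6 Claim 6 (pp. 26–27)] -/
theorem isAP_or_isTypeVI_of_card_eq_three {A B : Finset G} (hA3 : #A = 3) (hB3 : #B = 3)
    (hAB : #(A + B) = #A + #B) (hAqp : ¬ IsQuasiPeriodic A) (hBqp : ¬ IsQuasiPeriodic B) :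
    (∃ e, IsAP A e) ∨ (∃ e, IsAP B e) ∨ IsTypeVI A B := by
  classical
  have hlt : #(A + B) < #A * #B := by rw [hAB, hA3, hB3]; norm_num
  obtain ⟨a, ha, a', ha', b, hb, b', hb', hne, hdiff⟩ := exists_common_difference hlt
  have hd0 : a - a' ≠ 0 := fun h => hne (sub_eq_zero.1 h)
  have hsum : ((-a') +ᵥ A) + ((-b') +ᵥ B) = (-a' + -b') +ᵥ (A + B) := vadd_add_vadd_eq₄ A B _ _
  have key := isAP_or_eq_of_card_eq_three₀ (A := (-a') +ᵥ A) (B := (-b') +ᵥ B) hd0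
    (mem_vadd_finset.2 ⟨a', ha', by simp⟩)
    (mem_vadd_finset.2 ⟨a, ha, by rw [vadd_eq_add]; abel⟩)
    (mem_vadd_finset.2 ⟨b', hb', by simp⟩)
    (mem_vadd_finset.2 ⟨b, hb, by rw [vadd_eq_add, hdiff]; abel⟩)
    (by rw [card_vadd_finset]; exact hA3) (by rw [card_vadd_finset]; exact hB3)
    (by rw [hsum, card_vadd_finset, card_vadd_finset, card_vadd_finset]; exact hAB)
    (fun h => hAqp ((isQuasiPeriodic_vadd_iff _).1 h)) (fun h => hBqp ((isQuasiPeriodic_vadd_iff _).1 h))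
  rcases key with ⟨e, he⟩ | ⟨e, he⟩ | heq
  · exact Or.inl ⟨e, (isAP_vadd_iff _).1 he⟩
  · exact Or.inr (Or.inl ⟨e, (isAP_vadd_iff _).1 he⟩)
  · refine Or.inr (Or.inr ⟨hA3, hB3, ⟨a' + -b', ?_⟩, hAB⟩)
    have := congrArg (fun S : Finset G => a' +ᵥ S) heq
    simp only [vadd_vadd, add_neg_cancel, zero_vadd] at this
    exact this

/-! ### A non-quasi-periodic quasi-progression is a progression -/

/-- «Since `B` is not quasi-periodic, it follows that `d⊆(B, 𝒬𝒜𝒫_d) = 0` implies `B` is an arithmetic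
progression» (proof of Lemma 5.10): a quasi-progression with difference `d` which is not quasi-periodic
is an arithmetic progression with difference `d`. [cite: Grynkiewicz2009, Lemma 5.10 (proof)] -/
theorem isAP_of_isQuasiProgression_of_not_isQuasiPeriodic [Fintype G] {B : Finset G} {d : G}
    (hB : IsQuasiProgression d B) (hBqp : ¬ IsQuasiPeriodic B) : IsAP B d := by
  obtain ⟨P₁, P₀, hdec, hP₀, -⟩ := hB.exists_isQuasiPeriodicDecomp
  obtain ⟨-, hP₀B⟩ := hdec.left_eq_empty_of_not_isQuasiPeriodic hBqp
  rw [hP₀B] at hP₀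
  exact hP₀

/-! ### The case `|A| = |\overline{A + B}| = 3` -/

/-- **The case `|A| = |\overline{A + B}| = 3` of Theorem 4.1** («… it follows that the theorem holds
with type (VII)»), under the core-case standing assumptions (`G` finite, `0 ∈ A ∩ B`, `|B| ≥ 3`,
`|A + B| = |A| + |B|`, `A + B` aperiodic, `(A, B)` non-extendible, `⟨A⟩ = G`, `A`, `B` not
quasi-periodic): (17), or a decomposition (here with quasi-period `G` and `(A, B)` of type (VII)).
Proof: see the module docstring (Prop 2.4 dual pair `(−A, \overline{A + B})`, Lemma 5.4, the trichotomy
of Claim 6, Lemma 5.8 twice). [cite: Grynkiewicz2009, §6 (proof of Thm 4.1, p. 28)] -/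
theorem conclusion_of_card_eq_three_of_card_compl_eq_three [Fintype G] {A B : Finset G}
    (h0A : (0 : G) ∈ A) (h0B : (0 : G) ∈ B) (hA3 : #A = 3) (hB3 : 3 ≤ #B) (hC3 : #(A + B)ᶜ = 3)
    (hAB : #(A + B) = #A + #B) (haper : (A + B).addStab = {0})
    (hneA : IsNonExtendible A B) (hneB : IsNonExtendible B A)
    (hgen : AddSubgroup.closure (A : Set G) = ⊤) (hAqp : ¬ IsQuasiPeriodic A)
    (hBqp : ¬ IsQuasiPeriodic B) :
    (∃ α β : G, #(insert α A + insert β B) + 1 = #(insert α A) + #(insert β B)) ∨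
      ∃ (K : AddSubgroup G) (A₁ A₀ B₁ B₀ : Finset G), IsGrynkiewiczDecomp K A B A₁ A₀ B₁ B₀ := by
  classical
  have hAne : A.Nonempty := ⟨0, h0A⟩
  have hBne : B.Nonempty := ⟨0, h0B⟩
  have hBA : #(B + A) = #B + #A := by rw [add_comm, hAB, add_comm]
  have haper' : (B + A).addStab = {0} := by rwa [add_comm]
  -- the dual pair `(X, Y) = (−A, (A + B)ᶜ)` (Proposition 2.4)
  obtain ⟨hsum, hneX, hneY⟩ := isNonExtendible_pair_neg_compl hneA hneB
  have hX3 : #(-A) = 3 := by rw [card_neg, hA3]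
  have hGcard : Fintype.card G = #B + 6 := by
    have h1 := card_compl (A + B)
    have h2 := card_le_univ (A + B)
    omega
  have hBc : #Bᶜ = 6 := by rw [card_compl, hGcard]; omega
  have hXY : #(-A + (A + B)ᶜ) = #(-A) + #(A + B)ᶜ := by rw [hsum, hBc, hX3, hC3]
  have hBcne : Bᶜ.Nonempty := card_pos.1 (by omega)
  have hBaper : B.addStab = {0} := by
    by_contra h
    exact hBqp (((isPeriodic_iff_addStab_ne hBne).2 h).isQuasiPeriodic hBne)
  have haperXY : (-A + (A + B)ᶜ).addStab = {0} := by rw [hsum, addStab_compl hBne hBcne, hBaper]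
  have hXqp : ¬ IsQuasiPeriodic (-A) := by rwa [isQuasiPeriodic_neg_iff]
  have hYqp : ¬ IsQuasiPeriodic (A + B)ᶜ :=
    (not_isQuasiPeriodic_add_and_compl (by omega) (by omega) h0A h0B hAB haper hneA hneB hgen hAqp).2.1
  rcases isAP_or_isTypeVI_of_card_eq_three hX3 hC3 hXY hXqp hYqp with ⟨e, he⟩ | ⟨e, he⟩ | hVI
  · -- `−A`, hence `A`, is a progression: Lemma 5.8 for `(A, B)`
    have hA : IsAP A e := by have := he.neg; rwa [neg_neg] at this
    exact Or.inl (subsetDist_quasiProgression_of_isAP hAB (by omega) haper hA).2.2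
  · -- `(A + B)ᶜ` is a progression: Lemma 5.8 for `((A + B)ᶜ, −A)` makes `B` a quasi-progression
    have hYX : #((A + B)ᶜ + -A) = #(A + B)ᶜ + #(-A) := by rw [add_comm, hXY, add_comm]
    have haperYX : ((A + B)ᶜ + -A).addStab = {0} := by rw [add_comm]; exact haperXY
    have hq := subsetDist_quasiProgression_compl_of_isAP hYX (by omega) haperYX he
    rw [add_comm, hsum, compl_compl, subsetDist_eq_zero_iff] at hq
    have hB : IsAP B e := isAP_of_isQuasiProgression_of_not_isQuasiPeriodic hq hBqp
    exact Or.inl (seventeen_symm (subsetDist_quasiProgression_of_isAP hBA hB3 haper' hB).2.2)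
  · -- `(−A, (A + B)ᶜ)` of type (VI): `(A, B)` is of type (VII) with respect to `G`
    have hG : (⊤ : AddSubgroup G) ≠ ⊥ := by
      intro h
      have hx : ∀ x : G, x = 0 := fun x => by
        have hx : x ∈ (⊤ : AddSubgroup G) := AddSubgroup.mem_top x
        rw [h] at hx
        exact AddSubgroup.mem_bot.1 hx
      have hsub : A ⊆ {0} := fun x _ => mem_singleton.2 (hx x)
      have := card_le_card hsub
      rw [card_singleton] at this
      omega
    obtain ⟨y, hy⟩ : ((A + B)ᶜ).Nonempty := card_pos.1 (by omega)
    have h0X : (0 : G) ∈ -A := by rw [mem_neg', neg_zero]; exact h0A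
    have hdual : IsDualPair ⊤ (-A) (A + B)ᶜ A B := by
      refine ⟨0, h0X, y, hy, fun _ _ => AddSubgroup.mem_top _, fun _ _ => AddSubgroup.mem_top _,
        hneX, hneY, Or.inl ⟨0, 0, by rw [neg_neg, zero_vadd], fun z => ?_⟩⟩
      rw [hsum, sub_zero, mem_compl, not_not]
      exact ⟨fun h => ⟨AddSubgroup.mem_top _, h⟩, fun h => h.2⟩
    have hVII : IsTypeVII A B := ⟨⊤, -A, (A + B)ᶜ, Set.toFinite _, hVI, hdual⟩
    exact Or.inr ⟨⊤, ∅, A, ∅, B,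
      isGrynkiewiczDecomp_top_of_bottom hG hAne hBne (Or.inr (Or.inr (Or.inl hVII)))⟩

end Grynkiewicz2009

end Literature.Combinatorics.Additive
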